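import Summits.BirchSwinnertonDyer.BirchSwinnertonDyer.Theorems.ByReductionTypeAtTwoMultTransportTwistedDescentLocalEngine
import HarnessLib

/-!
# T-42-mult in the kernel, XXIV: `LIFT₃` from three LOCAL statements — the target at `2` (`T2`), the dual
# Kummer condition at `2` (`δ2`) and at `∞` (`δinf`); the exponent bookkeeping of Greenberg's
# «`S'_{T^*}(F)` is finite … hence `coker(γ')` is trivial» done at finite level

Cell `bsd-2adic` (run/shared/lean/pub/bsd-2adic/), seat `bsd-2adic-t42` (BRIEF-T42), GEN 16. HONEST FRAMING:
research route; THEOREMS ONLY (no `def`, no named fact, no instance); nothing booked; nothing re-keyed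
(RC-169); BSD is not proved by any of this. PARTITION: X5@2 multiplicative GV-transport rows (K4ᵐ B1·O1; the
residual `LIFT₃` of `hF3b`, file XXII `…TwistedDescentPT.lean`) × p = 2 — types-the-object-of; bears_on K4 items
19922 / 19923 (`--supports stmt-BirchSwinnertonDyer-19923`). Bricks (β1)+(β2)+(ζ) of
HOME/t42/DESIGN-T42-ADDENDUM-17.md: the assembly.

## What

`LIFT₃` (file XXII) asks, for all but finitely many odd `u` and every class `c`, for a level `J`, local targets
`t_v` over `ℚ` at `2` and `∞` hitting `loc_v c`, ORTHOGONAL to the dual Selmer group `H¹_{𝓕^*}(ℚ, E[2^J](χ_u)^D)`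
for every family of local invariant maps with the five printed properties. This file proves
`levelTarget_of_local : T2 → δ2 → δinf → LIFT₃` where the three hypotheses are LOCAL statements at ONE place:

* `T2` — local descent at `2` (Greenberg p. 124 «`𝒫^Σ(M, F) → 𝒫^Σ(M, F_∞)^Γ` … surjective», the place above
  `2`): for all but finitely many odd `u`, every `c ∈ H¹(ℚ_∞, E[2^∞])` with `ψ_u c` Kummer at `2` has, at some
  level `J`, a class `t ∈ H¹(ℚ₂, E[2^J](χ_u))` with `twistedTorsionToLocalH1 t = loc₂ c`;
* `δ2` — dual Kummer condition at `2` (Greenberg p. 123 «`L_v^*` is defined just as `L_v`», `v ∣ p`): a local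
  class `y' ∈ H¹(ℚ₂, E[2^J](χ_{u'}))` whose Weil dual `H¹(w) y'` annihilates the kernel of
  `twistedTorsionToLocalH1` (twist `χ_u`) is itself in the kernel of `twistedTorsionToLocalH1` (twist `χ_{u'}`);
* `δinf` — the same at a real place (Kummer image self-dual, Milne I 3.7 / Greenberg p. 109).

Proof (the memo's (β1)–(ζ), all other inputs being GEN 12–16 theorems): for `u` outside the finite union of
the bad sets of `T2`, of Greenberg's generic finiteness of `Sel_∞^{conj_γ = u}` (tree
`SelmerDualData.finite_setOf_int_infinite_conjH1_eq_zsmul`, exponent `2^a`) and of the twisted local invariants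
at an omitted prime `v₀ ∈ S₀` (`ZpExtension.finite_setOf_twisted_eigenvector`, exponent `2^f`), and with `2^b`
killing `E(ℚ_∞)[2^∞]` (`finite_torsion_cyclotomicZpExtension_holds`): take targets `t'` at level
`j' = max(J_T, ord c, f, 1)` (`T2` pushed up by `ι`, file `ZpExtensionGaloisTwistLevel`; at `∞`
`exists_twistedTorsionToLocalH1_eq_localResOver_infinitePlace`), set `J = j' + a + 2b`, `t = H¹(ι) t'`; for
`y ∈ H¹_{𝓕^*}(ℚ, E[2^J](χ_u)^D)`: `y = H¹(w) y'` (Weil duality, `ZpExtensionGaloisTwistWeilDual`),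
`twistedTorsionToH1 y' ∈ Sel_∞` (file XXIII + `δ2` + `δinf`), so `2^{a+2b} y' = 0`
(`ZpExtensionGaloisTwistExponentProofs`), so `2^{J−j'} y = 0`; `y` is locally trivial at `v₀` (strict), the
twisted invariants of `E[2^J](χ_u)^D ≅ E[2^J](χ_{u'})` at `v₀` are killed by `2^f ≤ 2^{j'}`, hence
`H¹(ι^D) y = 0` (`ZpExtensionGaloisTwistLevelDualProofs`) and `⟨H¹(ι) t'_v, y_v⟩_v = ⟨t'_v, loc_v H¹(ι^D) y⟩_v = 0`
(`ZpExtensionGaloisTwistLevelProofs`).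

What remains of `hF3b` after this file: the three local statements `T2`, `δ2`, `δinf` (and the PRINT-by-name
inputs {P49, `poitouTate_selmerStructure_duality_real ℚ`}; `δ2` will read Greenberg's Prop. 2.4 multiplicative,
`imKummer_ge_strictCondition_multiplicative_cyclotomic`, PRINT-by-name).

References: [GreenbergLNM1716] §4 pp. 107–109, 122–126; [GreenbergVatsal2000] §2 pp. 16–17; [MilneADT2006] I
Thm. 2.6, Cor. 2.3, Thm. 4.10; [SilvermanAEC2009] III.8.1.
-/

set_option autoImplicit false
set_option linter.dupNamespace false

noncomputable section

open scoped Classical ContRepresentation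

universe u

namespace Summit.BirchSwinnertonDyer.BirchSwinnertonDyer.Theorems.MultTransportTwistedDescent

open NumberField IsDedekindDomain Field WeierstrassCurve CategoryTheory
  Literature.NumberTheory.EllipticCurves Literature.NumberTheory.EllipticCurves.GreenbergVatsal2000
  Literature.NumberTheory.EllipticCurves.Greenberg1999
  Literature.NumberTheory.GaloisRepresentations Literature.NumberTheory.GaloisCohomology
  Summit.BirchSwinnertonDyer.BirchSwinnertonDyer.Theorems.MultTransportAtTwo
open Literature.NumberTheory.GaloisRepresentations.DiscreteGaloisModule (localTatePairingZMod
  unramifiedSubgroup SelmerStructure TateDual)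

/-! ## §2 `LIFT₃` from the three local statements -/

/-- **`levelTarget_of_local : T2 → δ2 → δinf → LIFT₃`** (the hypothesis of file XXII's `levelLift_of_orthogonal`).
For `u` odd outside the union of the finite bad sets of `T2`, of Greenberg's generic finiteness of
`Sel_∞^{conj_γ = u}` (`SelmerDualData.finite_setOf_int_infinite_conjH1_eq_zsmul`, needs `X` torsion) and of the
twisted invariants at an omitted prime `v₀ ∈ S₀` (`ZpExtension.finite_setOf_twisted_eigenvector` at a
`σ₂ ∈ Γ_{ℚ_{v₀}}` with `κ(σ₂) ≠ 1`, `exists_apply_resGal_ne_one_of_isCyclotomic`), the engine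
`exists_target_orthogonal` applies. [cite: GreenbergLNM1716, §4 pp. 122–126] -/
theorem levelTarget_of_local
    (T2 : ∀ (W : WeierstrassCurve ℚ) [W.IsElliptic] [W.IsGloballyMinimal],
      W.HasMultiplicativeReductionAtPrime 2 →
      ∀ (κ : ZpExtension ℚ 2) (_hκ : κ.IsCyclotomic) (γ : absoluteGaloisGroup ℚ)
        (_hγ : κ.IsTopGenerator γ),
      {u : ℤ | (2 : ℤ) ∣ u - 1 ∧
        ¬ ∀ c : W.subgroupH1 2 κ.kerSubgroup,
        (∀ v ∈ {v : HeightOneSpectrum (𝓞 ℚ) | ((2 : ℕ) : 𝓞 ℚ) ∈ v.asIdeal},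
            u • W.conjH1 2 κ.kerSubgroup γ c - c ∈ W.localKerOver 2 κ.kerSubgroup (v.adicCompletion ℚ)) →
        ∃ (hu : (2 : ℤ) ∣ u - 1) (J : ℕ),
          ∀ v ∈ {v : HeightOneSpectrum (𝓞 ℚ) | ((2 : ℕ) : 𝓞 ℚ) ∈ v.asIdeal},
            ∃ t : galoisCohomology
              ((W.twistedTorsionGaloisModule 2 κ J u hu).restrictField (v.adicCompletion ℚ)) 1,
              W.twistedTorsionToLocalH1 2 κ J u hu (v.adicCompletion ℚ) t =
                W.localResOver 2 κ.kerSubgroup (v.adicCompletion ℚ) c}.Finite)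
    (δ2 : ∀ (W : WeierstrassCurve ℚ) [W.IsElliptic] [W.IsGloballyMinimal],
      W.HasMultiplicativeReductionAtPrime 2 →
      ∀ (κ : ZpExtension ℚ 2) (_hκ : κ.IsCyclotomic) (J : ℕ) (u u' : ℤ) (hu : (2 : ℤ) ∣ u - 1)
        (hu' : (2 : ℤ) ∣ u' - 1) (huu' : ((2 : ℤ) ^ J) ∣ u * u' - 1)
        (e : W.geomTorsion ((2 ^ J : ℕ) : ℤ) → W.geomTorsion ((2 ^ J : ℕ) : ℤ) → AlgebraicClosure ℚ)
        (hμ : ∀ S T, e S T ^ (2 ^ J) = 1)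
        (hadd₁ : ∀ S₁ S₂ T, e (S₁ + S₂) T = e S₁ T * e S₂ T)
        (hadd₂ : ∀ S T₁ T₂, e S (T₁ + T₂) = e S T₁ * e S T₂)
        (hgal : ∀ (σ : absoluteGaloisGroup ℚ) (S T : W.geomTorsion ((2 ^ J : ℕ) : ℤ)),
          σ • e S T = e (σ • S) (σ • T))
        (_hnondeg : ∀ T, (∀ S, e S T = 1) → T = 0),
      ∀ [Finite (W.geomTorsion ((2 ^ J : ℕ) : ℤ))],
      ∀ (v : HeightOneSpectrum (𝓞 ℚ)), ((2 : ℕ) : 𝓞 ℚ) ∈ v.asIdeal →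
      ∀ (ιv : galoisCohomology ((DiscreteGaloisModule.mu ℚ (2 ^ J)).toLocal (Sum.inr v)) 2 →+ ZMod (2 ^ J)),
        Function.Bijective ιv →
      ∀ (y' : galoisCohomology
          ((W.twistedTorsionGaloisModule 2 κ J u' hu').restrictField (v.adicCompletion ℚ)) 1),
        (∀ a : galoisCohomology
            ((W.twistedTorsionGaloisModule 2 κ J u hu).restrictField (v.adicCompletion ℚ)) 1,
          W.twistedTorsionToLocalH1 2 κ J u hu (v.adicCompletion ℚ) a = 0 →
          localTatePairingZMod (W.twistedTorsionGaloisModule 2 κ J u hu) (2 ^ J) (Sum.inr v) ιv a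
            (galoisCohomology.map
              ((W.twistedWeilDual 2 κ J hu hu' huu' e hμ hadd₁ hadd₂ hgal).restrictField
                (v.adicCompletion ℚ)) 1 y') = 0) →
        W.twistedTorsionToLocalH1 2 κ J u' hu' (v.adicCompletion ℚ) y' = 0)
    (δinf : ∀ (W : WeierstrassCurve ℚ) [W.IsElliptic] [W.IsGloballyMinimal],
      W.HasMultiplicativeReductionAtPrime 2 →
      ∀ (κ : ZpExtension ℚ 2) (_hκ : κ.IsCyclotomic) (J : ℕ) (u u' : ℤ) (hu : (2 : ℤ) ∣ u - 1)
        (hu' : (2 : ℤ) ∣ u' - 1) (huu' : ((2 : ℤ) ^ J) ∣ u * u' - 1)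
        (e : W.geomTorsion ((2 ^ J : ℕ) : ℤ) → W.geomTorsion ((2 ^ J : ℕ) : ℤ) → AlgebraicClosure ℚ)
        (hμ : ∀ S T, e S T ^ (2 ^ J) = 1)
        (hadd₁ : ∀ S₁ S₂ T, e (S₁ + S₂) T = e S₁ T * e S₂ T)
        (hadd₂ : ∀ S T₁ T₂, e S (T₁ + T₂) = e S T₁ * e S T₂)
        (hgal : ∀ (σ : absoluteGaloisGroup ℚ) (S T : W.geomTorsion ((2 ^ J : ℕ) : ℤ)),
          σ • e S T = e (σ • S) (σ • T))
        (_hnondeg : ∀ T, (∀ S, e S T = 1) → T = 0),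
      ∀ [Finite (W.geomTorsion ((2 ^ J : ℕ) : ℤ))],
      ∀ (w : InfinitePlace ℚ)
        (ιw : galoisCohomology ((DiscreteGaloisModule.mu ℚ (2 ^ J)).toLocal (Sum.inl w)) 2 →+ ZMod (2 ^ J)),
        Function.Injective ιw →
      ∀ (y' : galoisCohomology ((W.twistedTorsionGaloisModule 2 κ J u' hu').restrictField w.Completion) 1),
        (∀ a : galoisCohomology ((W.twistedTorsionGaloisModule 2 κ J u hu).restrictField w.Completion) 1,
          W.twistedTorsionToLocalH1 2 κ J u hu w.Completion a = 0 →
          localTatePairingZMod (W.twistedTorsionGaloisModule 2 κ J u hu) (2 ^ J) (Sum.inl w) ιw a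
            (galoisCohomology.map
              ((W.twistedWeilDual 2 κ J hu hu' huu' e hμ hadd₁ hadd₂ hgal).restrictField w.Completion)
              1 y') = 0) →
        W.twistedTorsionToLocalH1 2 κ J u' hu' w.Completion y' = 0) :
    ∀ (W : WeierstrassCurve ℚ) [W.IsElliptic] [W.IsGloballyMinimal],
      W.HasMultiplicativeReductionAtPrime 2 →
      ∀ (κ : ZpExtension ℚ 2) (_hκ : κ.IsCyclotomic) (γ : absoluteGaloisGroup ℚ)
        (_hγ : κ.IsTopGenerator γ) (S₀ : Finset (HeightOneSpectrum (𝓞 ℚ)))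
        (_hne : S₀.Nonempty)
        (_hS₀ : ∀ v ∈ S₀, ((2 : ℕ) : 𝓞 ℚ) ∉ v.asIdeal)
        (_hbad : ∀ v : HeightOneSpectrum (𝓞 ℚ), v ∉ S₀ → ((2 : ℕ) : 𝓞 ℚ) ∉ v.asIdeal →
          W.HasGoodReductionAt v)
        (D : W.SelmerDualData κ γ) [Module.Finite (IwasawaAlgebra 2) D.X], D.IsTorsion →
      {u : ℤ | (2 : ℤ) ∣ u - 1 ∧
        ¬ ∀ c ∈ unramifiedOutside κ.kerSubgroup (W.geomPrimaryTorsion 2) 2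
            (↑S₀ : Set (HeightOneSpectrum (𝓞 ℚ))),
        (∀ v ∈ {v : HeightOneSpectrum (𝓞 ℚ) | ((2 : ℕ) : 𝓞 ℚ) ∈ v.asIdeal},
            u • W.conjH1 2 κ.kerSubgroup γ c - c ∈ W.localKerOver 2 κ.kerSubgroup (v.adicCompletion ℚ)) →
        (∀ w : InfinitePlace ℚ,
            u • W.conjH1 2 κ.kerSubgroup γ c - c ∈ W.localKerOver 2 κ.kerSubgroup w.Completion) →
        ∃ (hu : (2 : ℤ) ∣ u - 1) (J : ℕ)
          (t : Π v : Place ℚ,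
            galoisCohomology ((W.twistedTorsionGaloisModule 2 κ J u hu).toLocal v) 1),
          (∀ v : HeightOneSpectrum (𝓞 ℚ), ((2 : ℕ) : 𝓞 ℚ) ∉ v.asIdeal → t (Sum.inr v) = 0) ∧
          (∀ v ∈ {v : HeightOneSpectrum (𝓞 ℚ) | ((2 : ℕ) : 𝓞 ℚ) ∈ v.asIdeal},
            W.twistedTorsionToLocalH1 2 κ J u hu (v.adicCompletion ℚ) (t (Sum.inr v)) =
              W.localResOver 2 κ.kerSubgroup (v.adicCompletion ℚ) c) ∧
          (∀ w : InfinitePlace ℚ,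
            W.twistedTorsionToLocalH1 2 κ J u hu w.Completion (t (Sum.inl w)) =
              W.localResOver 2 κ.kerSubgroup w.Completion c) ∧
          (∀ [Finite (W.geomTorsion ((2 ^ J : ℕ) : ℤ))] (inv : LocalInvariants ℚ (2 ^ J)),
              inv.IsPerfect → inv.SumLocalTermEqZero → inv.UnramifiedOrthogonal → inv.SelmerComplement →
              inv.InjectiveAtRealPlaces →
            ∀ y ∈ (inv.dualSelmerStructure (W.twistedTorsionGaloisModule 2 κ J u hu)
                (W.twistedKummerSelmerStructure 2 S₀ κ J u hu)).selmerGroup,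
              (∀ v : HeightOneSpectrum (𝓞 ℚ), ((2 : ℕ) : 𝓞 ℚ) ∈ v.asIdeal →
                localTatePairingZMod (W.twistedTorsionGaloisModule 2 κ J u hu) (2 ^ J) (Sum.inr v)
                  (inv (Sum.inr v)) (t (Sum.inr v))
                  (galoisCohomology.localization
                    ((W.twistedTorsionGaloisModule 2 κ J u hu).tateDual (2 ^ J)) (Sum.inr v) 1 y) = 0) ∧
              (∀ w : InfinitePlace ℚ,
                localTatePairingZMod (W.twistedTorsionGaloisModule 2 κ J u hu) (2 ^ J) (Sum.inl w)
                  (inv (Sum.inl w)) (t (Sum.inl w))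
                  (galoisCohomology.localization
                    ((W.twistedTorsionGaloisModule 2 κ J u hu).tateDual (2 ^ J)) (Sum.inl w) 1 y) =
                  0))}.Finite := by
  intro W _ _ hW κ hκ γ hγ S₀ hne hS₀ hbad D _ hD
  -- an omitted prime and a local Galois element moving `ℚ_∞`
  obtain ⟨v₀, hv₀⟩ := hne
  obtain ⟨σ₂, hσ₂⟩ := Greenberg1999.exists_apply_resGal_ne_one_of_isCyclotomic hκ v₀
  have hσ₂' : absGaloisRestrict ℚ (v₀.adicCompletion ℚ) σ₂ ∉ κ.kerSubgroup := fun h ↦ hσ₂ h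
  -- the three finite bad sets
  have hB₁ := D.finite_setOf_int_infinite_conjH1_eq_zsmul hD
  have hB₂ := ZpExtension.finite_setOf_twisted_eigenvector κ W
    (absGaloisRestrict ℚ (v₀.adicCompletion ℚ) σ₂) (absGaloisRestrict ℚ (v₀.adicCompletion ℚ) σ₂) hσ₂'
  have hB₃ := T2 W hW κ hκ γ hγ
  obtain ⟨b, hb⟩ := exists_pow_smul_fixedPoints_eq_zero W κ hκ
  refine (hB₁.union (hB₂.union hB₃)).subset fun u hu ↦ ?_
  obtain ⟨hodd, hneg⟩ := hu
  by_contra hnot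
  simp only [Set.mem_union, not_or] at hnot
  obtain ⟨hn₁, hn₂, hn₃⟩ := hnot
  apply hneg
  intro c _hc h2 _hinf
  -- `2^a` kills the `u`-eigenvectors of `conj_γ` in `Sel_∞`
  have hfin : {s : W.selmerInfty κ |
      W.conjH1 2 κ.kerSubgroup γ (s : W.subgroupH1 2 κ.kerSubgroup) =
        u • (s : W.subgroupH1 2 κ.kerSubgroup)}.Finite :=
    Set.not_infinite.mp fun hinf ↦ hn₁ ⟨hodd, hinf⟩
  obtain ⟨a, ha⟩ := exists_pow_smul_eigen_eq_zero W κ hfin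
  -- `2^f` kills the twisted eigenvectors at `v₀`
  have hf : ∃ f : ℕ, ∀ (J : ℕ) (P : W.geomTorsion ((2 ^ J : ℕ) : ℤ)),
      absGaloisRestrict ℚ (v₀.adicCompletion ℚ) σ₂ • P =
        (u ^ κ.twistExponent J (absGaloisRestrict ℚ (v₀.adicCompletion ℚ) σ₂)) • P → 2 ^ f • P = 0 := by
    by_contra hcon
    push Not at hcon
    exact hn₂ ⟨hodd, hcon⟩
  obtain ⟨f, hf⟩ := hf
  -- the local targets at `2` (hypothesis `T2`)
  have hT : ∃ (hu : (2 : ℤ) ∣ u - 1) (J : ℕ),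
      ∀ v ∈ {v : HeightOneSpectrum (𝓞 ℚ) | ((2 : ℕ) : 𝓞 ℚ) ∈ v.asIdeal},
        ∃ t : galoisCohomology ((W.twistedTorsionGaloisModule 2 κ J u hu).restrictField (v.adicCompletion ℚ)) 1,
          W.twistedTorsionToLocalH1 2 κ J u hu (v.adicCompletion ℚ) t =
            W.localResOver 2 κ.kerSubgroup (v.adicCompletion ℚ) c := by
    by_contra hcon
    exact hn₃ ⟨hodd, fun hall ↦ hcon (hall c h2)⟩
  obtain ⟨hu', JT, hT⟩ := hT
  obtain ⟨J, t, h0, h2', hinf', horth⟩ := exists_target_orthogonal W κ hW hκ hγ S₀ hS₀ hbad hu' ha hb hv₀ σ₂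
    hf δ2 δinf c hT
  exact ⟨hu', J, t, h0, h2', hinf', horth⟩

/-- **`hF3b` from PRINT-by-name {Prop. 4.9, Poitou–Tate duality for Selmer structures} + the three LOCAL
statements `T2`, `δ2`, `δinf`** (composition with file XXII `hF3b_of_prop49_PT`). Record-only per RC-169 (no
display is re-keyed). [cite: GreenbergLNM1716, §4 Prop. 4.9, pp. 122–126] [cite: MilneADT2006, Ch. I, Thm. 4.10(b)] -/
theorem hF3b_of_prop49_local (h49 : prop49_noFiniteSubmodule_H1Sigma)
    (hPT : poitouTate_selmerStructure_duality_real ℚ)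
    (T2 : ∀ (W : WeierstrassCurve ℚ) [W.IsElliptic] [W.IsGloballyMinimal],
      W.HasMultiplicativeReductionAtPrime 2 →
      ∀ (κ : ZpExtension ℚ 2) (_hκ : κ.IsCyclotomic) (γ : absoluteGaloisGroup ℚ)
        (_hγ : κ.IsTopGenerator γ),
      {u : ℤ | (2 : ℤ) ∣ u - 1 ∧
        ¬ ∀ c : W.subgroupH1 2 κ.kerSubgroup,
        (∀ v ∈ {v : HeightOneSpectrum (𝓞 ℚ) | ((2 : ℕ) : 𝓞 ℚ) ∈ v.asIdeal},
            u • W.conjH1 2 κ.kerSubgroup γ c - c ∈ W.localKerOver 2 κ.kerSubgroup (v.adicCompletion ℚ)) →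
        ∃ (hu : (2 : ℤ) ∣ u - 1) (J : ℕ),
          ∀ v ∈ {v : HeightOneSpectrum (𝓞 ℚ) | ((2 : ℕ) : 𝓞 ℚ) ∈ v.asIdeal},
            ∃ t : galoisCohomology
              ((W.twistedTorsionGaloisModule 2 κ J u hu).restrictField (v.adicCompletion ℚ)) 1,
              W.twistedTorsionToLocalH1 2 κ J u hu (v.adicCompletion ℚ) t =
                W.localResOver 2 κ.kerSubgroup (v.adicCompletion ℚ) c}.Finite)
    (δ2 : ∀ (W : WeierstrassCurve ℚ) [W.IsElliptic] [W.IsGloballyMinimal],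
      W.HasMultiplicativeReductionAtPrime 2 →
      ∀ (κ : ZpExtension ℚ 2) (_hκ : κ.IsCyclotomic) (J : ℕ) (u u' : ℤ) (hu : (2 : ℤ) ∣ u - 1)
        (hu' : (2 : ℤ) ∣ u' - 1) (huu' : ((2 : ℤ) ^ J) ∣ u * u' - 1)
        (e : W.geomTorsion ((2 ^ J : ℕ) : ℤ) → W.geomTorsion ((2 ^ J : ℕ) : ℤ) → AlgebraicClosure ℚ)
        (hμ : ∀ S T, e S T ^ (2 ^ J) = 1)
        (hadd₁ : ∀ S₁ S₂ T, e (S₁ + S₂) T = e S₁ T * e S₂ T)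
        (hadd₂ : ∀ S T₁ T₂, e S (T₁ + T₂) = e S T₁ * e S T₂)
        (hgal : ∀ (σ : absoluteGaloisGroup ℚ) (S T : W.geomTorsion ((2 ^ J : ℕ) : ℤ)),
          σ • e S T = e (σ • S) (σ • T))
        (_hnondeg : ∀ T, (∀ S, e S T = 1) → T = 0),
      ∀ [Finite (W.geomTorsion ((2 ^ J : ℕ) : ℤ))],
      ∀ (v : HeightOneSpectrum (𝓞 ℚ)), ((2 : ℕ) : 𝓞 ℚ) ∈ v.asIdeal →
      ∀ (ιv : galoisCohomology ((DiscreteGaloisModule.mu ℚ (2 ^ J)).toLocal (Sum.inr v)) 2 →+ ZMod (2 ^ J)),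
        Function.Bijective ιv →
      ∀ (y' : galoisCohomology
          ((W.twistedTorsionGaloisModule 2 κ J u' hu').restrictField (v.adicCompletion ℚ)) 1),
        (∀ a : galoisCohomology
            ((W.twistedTorsionGaloisModule 2 κ J u hu).restrictField (v.adicCompletion ℚ)) 1,
          W.twistedTorsionToLocalH1 2 κ J u hu (v.adicCompletion ℚ) a = 0 →
          localTatePairingZMod (W.twistedTorsionGaloisModule 2 κ J u hu) (2 ^ J) (Sum.inr v) ιv a
            (galoisCohomology.map
              ((W.twistedWeilDual 2 κ J hu hu' huu' e hμ hadd₁ hadd₂ hgal).restrictField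
                (v.adicCompletion ℚ)) 1 y') = 0) →
        W.twistedTorsionToLocalH1 2 κ J u' hu' (v.adicCompletion ℚ) y' = 0)
    (δinf : ∀ (W : WeierstrassCurve ℚ) [W.IsElliptic] [W.IsGloballyMinimal],
      W.HasMultiplicativeReductionAtPrime 2 →
      ∀ (κ : ZpExtension ℚ 2) (_hκ : κ.IsCyclotomic) (J : ℕ) (u u' : ℤ) (hu : (2 : ℤ) ∣ u - 1)
        (hu' : (2 : ℤ) ∣ u' - 1) (huu' : ((2 : ℤ) ^ J) ∣ u * u' - 1)
        (e : W.geomTorsion ((2 ^ J : ℕ) : ℤ) → W.geomTorsion ((2 ^ J : ℕ) : ℤ) → AlgebraicClosure ℚ)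
        (hμ : ∀ S T, e S T ^ (2 ^ J) = 1)
        (hadd₁ : ∀ S₁ S₂ T, e (S₁ + S₂) T = e S₁ T * e S₂ T)
        (hadd₂ : ∀ S T₁ T₂, e S (T₁ + T₂) = e S T₁ * e S T₂)
        (hgal : ∀ (σ : absoluteGaloisGroup ℚ) (S T : W.geomTorsion ((2 ^ J : ℕ) : ℤ)),
          σ • e S T = e (σ • S) (σ • T))
        (_hnondeg : ∀ T, (∀ S, e S T = 1) → T = 0),
      ∀ [Finite (W.geomTorsion ((2 ^ J : ℕ) : ℤ))],
      ∀ (w : InfinitePlace ℚ)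
        (ιw : galoisCohomology ((DiscreteGaloisModule.mu ℚ (2 ^ J)).toLocal (Sum.inl w)) 2 →+ ZMod (2 ^ J)),
        Function.Injective ιw →
      ∀ (y' : galoisCohomology ((W.twistedTorsionGaloisModule 2 κ J u' hu').restrictField w.Completion) 1),
        (∀ a : galoisCohomology ((W.twistedTorsionGaloisModule 2 κ J u hu).restrictField w.Completion) 1,
          W.twistedTorsionToLocalH1 2 κ J u hu w.Completion a = 0 →
          localTatePairingZMod (W.twistedTorsionGaloisModule 2 κ J u hu) (2 ^ J) (Sum.inl w) ιw a
            (galoisCohomology.map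
              ((W.twistedWeilDual 2 κ J hu hu' huu' e hμ hadd₁ hadd₂ hgal).restrictField w.Completion)
              1 y') = 0) →
        W.twistedTorsionToLocalH1 2 κ J u' hu' w.Completion y' = 0) :
    ∀ (W : WeierstrassCurve ℚ) [W.IsElliptic] [W.IsGloballyMinimal],
      W.HasMultiplicativeReductionAtPrime 2 →
      ∀ (κ : ZpExtension ℚ 2) (_hκ : κ.IsCyclotomic) (γ : absoluteGaloisGroup ℚ)
        (_hγ : κ.IsTopGenerator γ) (S₀ : Finset (HeightOneSpectrum (𝓞 ℚ)))
        (_hne : S₀.Nonempty)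
        (_hS₀ : ∀ v ∈ S₀, ((2 : ℕ) : 𝓞 ℚ) ∉ v.asIdeal)
        (_hbad : ∀ v : HeightOneSpectrum (𝓞 ℚ), v ∉ S₀ → ((2 : ℕ) : 𝓞 ℚ) ∉ v.asIdeal →
          W.HasGoodReductionAt v)
        (D : W.SelmerDualData κ γ) [Module.Finite (IwasawaAlgebra 2) D.X], D.IsTorsion →
        ∀ (DS : NonPrimitiveDualData W κ γ (↑S₀ : Set (HeightOneSpectrum (𝓞 ℚ))))
          (N : Submodule (IwasawaAlgebra 2) DS.X), Finite N → N = ⊥ :=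
  hF3b_of_prop49_PT h49 hPT (levelTarget_of_local T2 δ2 δinf)

end Summit.BirchSwinnertonDyer.BirchSwinnertonDyer.Theorems.MultTransportTwistedDescent

end
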